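import Mathlib
import Literature.NumberTheory.GaloisRepresentations.SerreWeight
import Literature.NumberTheory.GaloisRepresentations.ResidualPair
import Literature.NumberTheory.GaloisRepresentations.ResidualPairIntegrality
import Literature.NumberTheory.GaloisRepresentations.FramedRepBaseChange
import Literature.NumberTheory.GaloisRepresentations.ArtinRestriction
import Literature.NumberTheory.Automorphic.AdicCompletionLocalField
import Literature.NumberTheory.Automorphic.GLnAdelicStructureProofs
import Literature.NumberTheory.DiophantineGeometry.AVGaloisModule
import Literature.NumberTheory.DiophantineGeometry.AVGaloisModuleContinuityProofs
import Literature.NumberTheory.DiophantineGeometry.AVGaloisModuleTateRankOfCubeProofs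
import Literature.NumberTheory.DiophantineGeometry.AbelianVarietyOrdinaryReduction
import Literature.FieldTheory.AlgClosed.PadicAlgClEquivComplex
import HarnessLib

/-!
# WeilPairingRationalTateModule

Topic `Literature/NumberTheory/DiophantineGeometry`. Named literature fact(s) relocated by the gate from `Summits/Langlands/Langlands/Theorems/PhantomRMYoshidaStableYoshidaCongruenceFramedH1.lean`
(accept-time relocation of `[cite]`d propositions written inline in a Summits proposal; human ruling 2026-08-15).
Sources: Milne1986AbelianVarieties, MumfordAV1970.

* `Literature.NumberTheory.DiophantineGeometry.weilPairing_rationalTateModule`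
-/

namespace Literature.NumberTheory.DiophantineGeometry

open CategoryTheory IsDedekindDomain
open scoped NumberField Matrix
open Literature.NumberTheory.GaloisRepresentations Literature.NumberTheory.Automorphic
open Literature.AlgebraicGeometry.Motives (AbelianVariety)

/-- **The Weil pairing of a polarisation makes `V_p` of an abelian variety symplectic with multiplier
the cyclotomic character.**  For an abelian variety `B` over a field `K` and a prime `p` invertible
in `K`: the pairings `ē_{pⁿ} : B[pⁿ] × B^∨[pⁿ] → μ_{pⁿ}` are non-degenerate pairings of
`Gal(K̄/K)`-modules and assemble to `e_p : T_p B × T_p B^∨ → ℤ_p(1)` (Milne, *Abelian varieties*, §16,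
Lemma 16.1); for `λ = φ_L : B → B^∨` the polarisation of an ample `L` (which exists and is defined
over `K`: `B` is projective, §7 Thm. 7.1, with an ample divisor over `K`, ibid. proof; §13)
`e_p^λ(x, y) = e_p(x, λ y)` is SKEW-SYMMETRIC (Lemma 16.2 (e): `L ↦ e_p^L ∈ Hom(Λ² T_p B, ℤ_p(1))`;
Mumford §20) and non-degenerate on `V_p B = T_p B ⊗ ℚ_p` (`λ` is an isogeny, `e_p` is perfect), and
`Γ_K` acts on `ℤ_p(1) ≅ ℤ_p` through the cyclotomic character `χ_p` (`λ` being `K`-rational,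
`e_p^λ(g x, g y) = g · e_p^λ(x, y)`).  Recorded over the tree's `rationalTateModule` / `rationalTateRep` /
`GaloisRep.cyclotomicCharacter`: there is a non-degenerate alternating `ℚ_p`-bilinear form `e` on
`V_p B` with `e(g x, g y) = χ_p(g) e(x, y)` for all `g ∈ Γ_K`.
[cite: Milne1986AbelianVarieties, §16 (pairings ē_m, e_l, e_l^λ; Lemma 16.1, Lemma 16.2 (e); PDF pp. 198–201), §13 (polarizations, PDF p. 194), Thm. 7.1 (PDF p. 178)]
[cite: MumfordAV1970, §20 (the e_n-pairing and the Riemann form of a line bundle)]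
[topic NumberTheory/DiophantineGeometry] -/
def weilPairing_rationalTateModule : Prop :=
  ∀ {K : Type} [Field K] (B : AbelianVariety K) (p : ℕ) [Fact p.Prime], (p : K) ≠ 0 →
    ∃ e : LinearMap.BilinForm ℚ_[p] (B.rationalTateModule p), e.IsAlt ∧ e.Nondegenerate ∧
      ∀ (g : Field.absoluteGaloisGroup K) (x y : B.rationalTateModule p),
        e (B.rationalTateRep p g x) (B.rationalTateRep p g y) =
          (((GaloisRep.cyclotomicCharacter K p g : ℤ_[p]ˣ) : ℤ_[p]) : ℚ_[p]) * e x y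

end Literature.NumberTheory.DiophantineGeometry
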